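import Summits.BirchSwinnertonDyer.Rank1Residual.F1Sign2.LevelZeroSpinLawPosDiscAtTwoKernel
import HarnessLib.Audit.Tags
import HarnessLib

/-!
# DESC-44 «LEVEL 1 ON THE UNIT PLANE» — the rigid-twist INCREMENT of the Cassels–Tate bit is CONGRUENCE-BLIND; the FLIPPED family (typer -ty g21 port of -desc g34's
# MEMO-desc §44 / §44.10, `MEMO-desc-data/g34/lean/Sketch44.lean` v2 cc7b15935ad3fb05)

PORT (typer -ty g21, PORT REQUEST -desc g34 01:44Z/02:03Z; REF1 gates §290 (v1) + §295 (v2 cc7b15935ad3fb05)): carriers `RigidThreeCycleTwist`, `UnitPlaneSeedAtTwo`, `IncrementTrivialAtTwo`,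
`FlippedThreeCycleTwist` and rows DESC-44-C `UnitPlaneCongruentIncrementLawAtTwo` (LEAD, THM 44.1; PLAIN — corollary-of-print assembly Morgan 2023 Prop. 19 ∘ THM 43.0,
REF1 §290 K290.2 step (d) VERIFIED), DESC-44-T `UnitPlaneTwistPairIncrementLawAtTwo` (PLAIN, ⊂ C by PROVED glue), DESC-44-L0 `UnitPlaneCongruentCasselsTateSignDiffersAtTwo`
(`@[conjecture]` — typer's tag for REF1's «numerical» ∃-claim, see its rider), DESC-44-F `UnitPlaneFlippedTwistSelmerCardAtTwo` (PLAIN — corollary-of-print assembly, REF1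
§295) — bodies and docstrings VERBATIM from the sketch, riders appended (REF1 §290/§295 audit text, REF2 placement owed).  **DESC-44-V `UnitPlaneRigidCasselsTateSignVariesAtTwo`
is NOT PORTED (HELD, REF1 R290b/R295d): FALSE AS TYPED** — the carrier `UnitPlaneSeedAtTwo` dropped DESC-43-U's `Irreducible (twoDivisionUCubic W)`, so a curve with a
rational 2-torsion point (candidate 65a1 ⊗ `X³ − 4X − 1`) is a «seed» whose only rigid parameter is `n = 1` (REF1 §290 K290.3, kernel lemma `desc44V_false_of_twoTorsionSeed`
in `REF1-data/b290/Probe290.lean`); the one-conjunct repair V′ (Morgan 2023 Thm. 39, theorem-grade in print modulo the model dictionary) awaits -desc's v3.  The three glue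
theorems (`unitPlaneTwistPairIncrementLaw_of_congruent`, `incrementBits_aux`, `unitPlane_twist_bits_of_incrementLaw`) and REF1's probes K290.1/.2/.4/.6 + K295.1–.4 are in the
kernel sibling `…UnitPlaneIncrementLawAtTwoKernel.lean` (K290.3/3′ mention the held V and K290.5/5′ need the auxiliary `def W65` — left in REF1's evidence file).  -desc's
definition requests D44.1 `NormOneUnitNonsquareAtDegOnePrime` (typable, Mathlib number-field algebra) / D44.2 `twistKummerLocalAt` (local Kummer image at a multiplicative
prime — not in tree) are recorded as OPEN, not filed here.  Nothing in this file is asserted: every row is a `def … : Prop`; BSD is not proved; 23715 is not closed.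

SKETCH HEADER (-desc g34, VERBATIM):

# Sketch44 (-desc g34, MEMO-desc §44): LEVEL 1 ON THE UNIT PLANE — the rigid-twist INCREMENT of the Cassels–Tate bit is CONGRUENCE-BLIND

Setting (§43): `W(ℚ)[2] = 0`, `Gal(L/ℚ) = S₃` (`L` = the cubic field of the 2-division cubic), `h_L` odd, `Δ_L > 0`, EVERY place switched off (sharp), `#Sel₂(W) = 4`;
then THM 43.0 gives `Sel₂(W) = Ũ` := the norm-one unit plane of `L^×/L^{×2}` (a datum of `L` alone).  Such a `W` is a UNIT-PLANE SEED (`UnitPlaneSeedAtTwo`).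
A RIGID 3-CYCLE TWIST parameter is `n ≥ 1` squarefree, `n ≡ 1 (8)`, `(n/ℓ) = +1` at every odd bad prime `ℓ`, every prime `q ∣ n` good with `a_q` odd (`Frob_q` a 3-cycle on `W[2]`,
so `H¹(ℚ_q, W[2]) = 0`): then `W^{(n)} ≅ W` over `ℚ₂`, `ℚ_ℓ`, `ℝ` and `Sel₂(W^{(n)}) = Sel₂(W)` inside `H¹(ℚ, W[2])` (Kramer / Mazur–Rubin; Morgan 2023 Lemma 16).
LEVEL-1 BIT `θ(X) := [Ш(X)[2] ⊆ 2Ш(X)[4]]` (tree `ShaTwoInTwiceShaFour`; = «the Cassels–Tate form on `Sel₂(X)` vanishes» when `X(ℚ)[2] = 0` and rank `0`… in general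
`= [CT ≡ 0 on the image of Sel₂ in Ш[2]]`); INCREMENT `δ_W(n) := θ(W^{(n)}) ⊕ θ(W)`.

* THM-CANDIDATE 44.1 (= DESC-44-C `UnitPlaneCongruentIncrementLawAtTwo`, in-print assembly): two unit-plane seeds `E₀`, `E₁` with the SAME cubic field (a shared
  cubic datum `c`) have the SAME increment at every common rigid `n`: `δ_{E₀}(n) = δ_{E₁}(n)`.  Proof sketch: the unique `Gal`-isomorphism `E₀[2] ≅ E₁[2]` (both the
  standard `S₃`-module of `L`; `End_G = 𝔽₂`) identifies `H¹(ℚ, Eᵢ[2])` with `ker(N : L^×/L^{×2} → ℚ^×/ℚ^{×2})`, the Weil pairings (the unique non-degenerate alternating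
  form on `𝔽₂²`) and, by THM 43.0, the Selmer groups (`= Ũ` on both sides).  Morgan 2023 Def. 17 + Prop. 19: for `𝔞, 𝔟 ∈ Sel₂` and `χ` trivial on `Σ ⊇ {v ∣ 2N∞}`
  with `E[2]^{Frob_v} = 0` on `Ram χ ∖ Σ`, `CTP(𝔞,𝔟) + CTP_χ(𝔞,𝔟) = Σ_{v ∈ Ram χ} ψ_{a,b}(Frob_v)` where `ψ_{a,b}(σ) = e₂(P_{a,σ}, b(σ)) + γ_{a,b}(σ)` is built from
  the cocycles `a, b`, the module `E[2]`, its Weil pairing and a cochain `γ_{a,b}` with `dγ = a ∪ b` — NOTHING ELSE OF THE CURVE; `γ` may be taken unramified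
  outside `2N_{E₀}∞` (`Ш²_Σ(μ₂) = Ш¹_Σ(ℤ/2)^∨ = 0` and `a ∪ b` is locally trivial on `Σ` by isotropy), so with `Σ = {v ∣ 2N₀N₁∞}` the right-hand side is the
  same for `E₀` and `E₁`; the CT form on `Sel₂ ≅ 𝔽₂²` is alternating (Cassels), hence one bit `CTP(𝔞,𝔟)`, and `θ = [that bit = 0]` (MS21 Thm 1.3: radical = `2Sel₄`).
  So `δ_{E₀}(χ) = ψ_{a,b}(Frob) summed = δ_{E₁}(χ)`.  (Level 0 is NOT blind: DESC-44-L0, §20's theta-discrepancy.)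
* DESC-44-T `UnitPlaneTwistPairIncrementLawAtTwo`: the sub-case `E₁ ≅ E₀^{(D)}` (also from Morgan–Smith 2024 Thm 8.4 over `ℚ(√D)`); glue `C → T` PROVED.
* DESC-44-V `UnitPlaneRigidCasselsTateSignVariesAtTwo`: on every unit-plane seed `θ(W^{(n)})` takes both values on rigid `n` (Morgan 2023 Thm 12 with
  `Sel₂ ∩ H¹(S₃, W[2]) = 0`: every alternating pairing on `Sel₂` is a `CTP_χ` with `Sel₂(W^χ) = Sel₂(W)`).
* DESC-44-L0 `UnitPlaneCongruentCasselsTateSignDiffersAtTwo` (numerical ∃-fact): congruent unit-plane seeds with OPPOSITE level-0 bit exist (`X18n35`: `θ = +`,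
  `X4n236`: `θ = −`, same cubic field `x³ − 7x − 5`, `Δ_L = 697`; PARI `ellrank` s + ENGINE CT-2) — `θ` is not a function of `(E[2], Sel₂)`, its rigid derivative is.
Data: kit j337311 (PREDICTIONS44.md pre-registered, 235 seeds = 231 rank-2 curves (`Ũ = δ(E(ℚ))`) + 4 rank-0 curves (`Ũ = Ш[2]`), 150 prime rigid twists each, 0 timeouts,
engines PARI `ellrank` / Fisher-Gram CT-2 agree 9 635/9 635): P44.0 `dim Sel₂(E^{(n)}) = 2` 42 065/42 065; P44.1 affinity 6 580/6 580 square quadruples; P44.2 twist pairs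
450/450; P44.3 congruent non-twist pairs 22 200/22 200 (naive 21 300; CONTROL cross-field 0.504); P44.6 the increment is NOT a function of `q mod 8·rad N` (2 238 residue
classes carry both values, 161 seeds; e.g. `X20n65 = [0,0,0,−12,−10]`, `q = 337, 2521 ≡ 25 (312)`).
Nothing asserted, no `sorry`, no new axiom; plain `def … : Prop` rows + one proved glue.
-/

noncomputable section

open scoped Classical

open WeierstrassCurve Literature.NumberTheory.EllipticCurves Literature.NumberTheory.DiophantineGeometry Polynomial IsDedekindDomain NumberField

namespace Summit.BirchSwinnertonDyer.Rank1Residual.F1Sign2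

/-! ### §44 vocabulary -/

/-- RIGID 3-CYCLE TWIST parameter `n` (positive branch): `n ≥ 1` squarefree with odd good prime factors, `n ≡ 1 (mod 8)`, `(n/ℓ) = +1` at every odd prime `ℓ` of bad
reduction, and every prime `q ∣ n` a 3-CYCLE prime (`a_q` odd ⟺ the 2-division cubic is irreducible mod `q` ⟺ `W[2]^{Frob_q} = 0`).  Then `W^{(n)} ≅ W` over `ℚ₂`,
every `ℚ_ℓ` and `ℝ`, and `H¹(ℚ_q, W[2]) = 0` at `q ∣ n`, so `Sel₂(W^{(n)}) = Sel₂(W)` in `H¹(ℚ, W[2])`.  (`n = 1` is rigid.  = `GenusTrivialTwistMember` without its split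
factor `p`; = the positive mirror of `DescAdmissible`, which hard-codes `d < 0`.)
(RIDER, typer -ty g21: carrier VERBATIM.  REF1-AUDIT §290 K290.1 (-ref1 g23, Probe290 rc 0 · 0 warn · 0 sorry): = Morgan 2023 Lemma 16 / Prop. 19 hypotheses on
`χ = χ_n` over ℚ VERBATIM in arithmetic dress: «`res_v χ` trivial for all `v ∈ Σ ⊇ {v ∣ 2N_A∞}`» ⟸ `n ≡ 1 (8)` (square in ℚ₂), `n > 0` (trivial at ∞), `(n/ℓ) = +1`
and `ℓ ∤ n` at odd bad `ℓ`; «`A[2]^{Frob_v} = 0` on `Ram χ ∖ Σ`» ⟸ `a_q` odd at `q ∣ n`; `n = 0` excluded by `% 8 = 1`; = tree `GenusTrivialTwistMember` without its split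
factor ✓ (R290e: consider defining the latter from this carrier).  Kernel: `rigid_one` (K290.1: `n = 1` is rigid for every `W`) and `rigid_eq_one_of_even_traces`
(K290.2: if every odd good trace is even — any curve with a rational 2-torsion point — the only rigid parameter is `n = 1`).
[cite: Morgan2023KummerGeneric, Lemma 16 and Prop. 19]) -/
def RigidThreeCycleTwist (W : WeierstrassCurve ℚ) [W.IsGloballyMinimal] (n : ℕ) : Prop :=
  TwistSupportGoodOdd W n ∧ (n : ℤ) % 8 = 1 ∧
    (∀ ℓ : ℕ, ℓ.Prime → ℓ ≠ 2 → (∀ _h : Fact ℓ.Prime, ¬ W.HasGoodReductionAtPrime ℓ) → jacobiSym (n : ℤ) ℓ = 1) ∧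
    ∀ q : ℕ, q.Prime → q ∣ n → Odd (W.frobeniusTrace q)

/-- UNIT-PLANE SEED with cubic datum `c` (= the hypotheses of DESC-43-U `EggAlignedOfSelmerFourAllOffAtTwo`): `c` a cubic datum for `W` (monic irreducible `S₃` cubic whose
root field carries a root of the 2-division polynomial — so `L ≅ ℚ[X]/(c)`), `B2 B4 B6` the b-invariants, `#Sel₂(W) = 4`, `h_L` odd (`DegOnePrimesOddClassC c`), `Δ_L > 0`,
and EVERY place switched off (sharp).  THM 43.0: then `Sel₂(W) = Ũ`, the norm-one unit plane of `L` — a datum of `c` alone.  Two seeds SHARING `c` are 2-CONGRUENT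
(`E₀[2] ≅ E₁[2]`) with identified Selmer groups.
(RIDER, typer -ty g21: carrier VERBATIM — WITH A KNOWN GAP (REF1 §290 K290.1/K290.3, R290a): the docstring's «= the hypotheses of DESC-43-U» is
INEXACT — DESC-43-U (`EggAlignedOfSelmerFourAllOffAtTwo`, `LevelZeroSpinLawPosDiscOddAtTwo.lean`) ALSO binds `[Fact (Irreducible (twoDivisionUCubic W))]`
(`W(ℚ)[2] = 0`), which this conjunction does not carry.  JUNK SEEDS therefore exist: any curve with a RATIONAL 2-torsion point of abscissa `k/xden` and
`xnum := C k` satisfies the `CubicDatumFor` divisibility conjunct for EVERY cubic `c` (kernel `cubicDatum_dvd_of_rational_root`, K290.4), e.g. Cremona 65a1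
`⟨1,0,0,−1,0⟩` ⊗ `c = X³ − 4X − 1` (disc 229, `S₃` by kernel `not_isSquare_229`; `#Sel₂ = 4`, all places sharp-OFF, `h = 1` — REF1's table facts ①②③); on
junk seeds the only rigid parameter is `n = 1` (even traces).  CONSEQUENCES (REF1): DESC-44-C and DESC-44-T are true-but-trivial on junk pairs, DESC-44-L0 cannot be
satisfied by junk (a junk seed has `Ш[2] = 0`), DESC-44-F is VACUOUS at junk seeds (K295.2/.3) — so the gap is load-bearing ONLY for DESC-44-V
`UnitPlaneRigidCasselsTateSignVariesAtTwo`, which is FALSE AS TYPED (kernel lemma `desc44V_false_of_twoTorsionSeed` in `REF1-data/b290/Probe290.lean`) and is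
therefore NOT PORTED here (HELD per R290b/R295d until -desc files V′ = V over the repaired carrier `… ∧ Irreducible (twoDivisionUCubic W)`, under which V′ is
Morgan 2023 Thm. 39 — theorem-grade in print modulo the model dictionary, K290.4).  R290a (-desc): add the conjunct (hygiene for C, T, L0, F too; with it F's
`w(W) = +1` step is honest, §295 A2 (i)).  K295.4 (kernel `switchedOffSharpAt_odd_iff`): at an odd place the sharp-OFF clause is literally THM 39.1's
`SwitchedOffAt`.) -/
def UnitPlaneSeedAtTwo (W : WeierstrassCurve ℚ) [W.IsGloballyMinimal] (c xnum : ℤ[X]) (xden : ℕ) (B2 B4 B6 : ℤ) : Prop :=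
  CubicDatumFor W c xnum xden ∧ BInvariantsZ W B2 B4 B6 ∧ selmerTwoCard W = 4 ∧ DegOnePrimesOddClassC c ∧ 0 < cubicDiscZ c ∧
    ∀ (v : HeightOneSpectrum (𝓞 ℚ)) (ℓ : ℕ), PlaceOver v ℓ → SwitchedOffSharpAt W c (twoDivisionCubicZ B2 B4 B6) v ℓ

/-- THE LEVEL-1 INCREMENT VANISHES at `n`: `δ_W(n) = 0`, i.e. `θ(W^{(n)}) = θ(W)` (`θ` = tree `ShaTwoInTwiceShaFour`).
(RIDER, typer: carrier VERBATIM.  REF1 §290 T290a / R290d: at `n = 1` this compares `θ` of `W.quadraticTwist 1` (the b-model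
`⟨0, b₂/4, 0, b₄/2, b₆/4⟩`) with `θ(W)` — two ISOMORPHIC models (tree `exists_variableChange_quadraticTwist_one`), so `IncrementTrivialAtTwo W 1` is true by
transport of `sha` along the isomorphism, not by `rfl`; a kernel glue `incrementTrivial_one` would make it explicit (not supplied by the sketch).
[cite: MorganSmith2021CTP, Thm 1.3]) -/
def IncrementTrivialAtTwo (W : WeierstrassCurve ℚ) (n : ℕ) : Prop :=
  ShaTwoInTwiceShaFour (W.quadraticTwist ((n : ℤ) : ℚ)) ↔ ShaTwoInTwiceShaFour W

/-! ### §44 rows -/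

/-- **DESC-44-C `UnitPlaneCongruentIncrementLawAtTwo` (LEAD; THEOREM-CANDIDATE 44.1, in-print assembly; plain `def`, nothing asserted).**  Two unit-plane seeds `E₀`, `E₁`
with the SAME cubic datum `c` (same cubic field `L`, `Sel₂(E₀) = Sel₂(E₁) = Ũ`; different `j` allowed) have the SAME level-1 increment at every common rigid 3-cycle twist:
`θ(E₀^{(n)}) ⊕ θ(E₀) = θ(E₁^{(n)}) ⊕ θ(E₁)`.  Assembly: Morgan 2023 Def. 17 + Prop. 19 (`CTP + CTP_χ = Σ_{v ∈ Ram χ∖Σ} ψ_{a,b}(Frob_v)`, `ψ_{a,b}` built from the cocycles,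
`E[2]` and its Weil pairing only; hypotheses «`res_v χ` trivial for `v ∈ Σ ⊇ {v ∣ 2N_A∞}`, `A[2]^{Frob_v} = 0` on `Ram χ ∖ Σ`» = rigidity, with `Σ = {v ∣ 2N₀N₁∞}` and one
`γ_{a,b}` unramified outside `2N₀∞`), the unique `Gal`-isomorphism `E₀[2] ≅ E₁[2]`, THM 43.0 on both sides, CT alternating on `Sel₂ ≅ 𝔽₂²` (one bit) and MS21 Thm 1.3
(`θ = +` ⟺ that bit vanishes).  BC5 (kit job44, pre-registered P44.3): congruent NON-twist pairs, increments agree 56/56 on common prime twists while the naive bits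
agree 40/56 and cross-field pairs agree 12/24 (coin) [smoke j337277]; FULL kit j337311: 148 congruent non-twist pairs in 97 cubic fields, increments agree
22 200/22 200 on common prime rigid twists (150 per pair; 18 300/18 300 spanning-tree-independent), naive bits 21 300/22 200, CONTROL (pairs from different cubic fields)
372 107/738 670 = 0.504; 145/148 pairs are NOT congruent mod 4 (`a_p mod 4` differ).  Why it might fail: only through the model ↔ cohomology dictionary (`(W.quadraticTwist n).sha` vs `Ш(E^{χ_n})`,
§17's `TwistModelDictionaryAtTwo`) or the OFF dictionary inside THM 43.0 (`Sel₂ = Ũ`).  Sources: [cite: Morgan2023KummerGeneric, Def. 17, Rem. 18, Prop. 19, Rem. 20];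
[cite: MorganSmith2021CTP, Thm 1.3]; [cite: MazurRubin2015SelmerCompanions]; MEMO-desc §43 (THM 43.0), §44.
(RIDER, typer -ty g21: PLAIN `def` (corollary-of-print assembly, REF1 R290c).  REF1-AUDIT §290 (-ref1 g23; Probe290 = Sketch44 v1 886ef569fbfba3f9
verbatim + block `REF1_290`, farm rc 0 · 0 warn · 0 sorry; negative control fails where it should; v2 cc7b15935ad3fb05 leaves this row byte-identical, §295):
**SURVIVES; THM 44.1 is a CORRECT IN-PRINT ASSEMBLY modulo THM 43.0 (`Sel₂ = Ũ`, DESC-43-U) and the model dictionary** — K290.2: (a) same `c` for both seeds ⟹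
(junk aside) `L₀ = L₁ = ℚ[X]/(c)` ⟹ `E₀[2] ≅ E₁[2]` uniquely (`End_{S₃} = 𝔽₂`), Weil pairings match; (b) THM 43.0 on both sides; (c) Morgan Def. 17 / Prop. 19 quoted from
the held text: `ψ_{a,b}` is built from the cocycles, `A[2]`, `e₂` and `γ` ONLY — -desc's «NOTHING ELSE OF THE CURVE» is CORRECT; the paper's standing hypothesis from
§2 on is «principally polarised abelian variety over a number field», so `E/ℚ` qualifies; (d) VERIFIED: `a ∪ b ∈ H²(G_{ℚ,Σ₀}, μ₂)` has zero local invariants and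
`Ш¹_{Σ₀}(ℤ/2) = 0` over ℚ ⟹ `γ` unramified outside `2N₀∞`; `Σ := {v ∣ 2N₀N₁∞}` serves both applications of Prop. 19 and the two rigidity hypotheses are exactly
«`χ_n` trivial on `Σ`, `Eᵢ[2]^{Frob} = 0` on `Ram χ_n`»; same `(a, b, γ, Σ)` ⟹ same right-hand side ⟹ equal increments; (e) CT alternating on `Sel₂ ≅ 𝔽₂²` ⟹ one bit.
K290.3: on JUNK pairs (see the `UnitPlaneSeedAtTwo` rider) the row is TRUE for the trivial reason (only `n = 1` is common-rigid) — harmless but meaningless there.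
K290.5 (mutation): dropping «same `c`» is false (P44.3 control 0.504) ✓ load-bearing; dropping `(n/ℓ) = 1` or `n ≡ 1 (8)` — `Sel₂` no longer preserved ✓ load-bearing;
`DegOnePrimesOddClassC`, `0 < cubicDiscZ`, all-OFF enter only through THM 43.0 — WITHOUT it the assembly still proves the companion form C♮ «2-congruent curves whose
`Sel₂` coincide under the Kummer identification have equal increments» (a cleaner, dictionary-lighter lead -desc may prefer to type); quantifier per polynomial `c`
(not per field) loses nothing.  PLACEMENT (REF1 input R290c): corollary-of-print (Morgan 2023 Prop. 19 ∘ THM 43.0; step (d) a two-line Poitou–Tate remark over ℚ);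
the CROSS-CONGRUENCE reading «Selmer companions have rigid-twist-invariant 4-Selmer discrepancy» has no printed statement (Morgan's Prop. 19 is per-curve; the
two-curve comparison is the new sentence).  REF2 placement: owed.
[cite: Morgan2023KummerGeneric, Def. 17 and Prop. 19]) -/
def UnitPlaneCongruentIncrementLawAtTwo : Prop :=
  ∀ (E₀ E₁ : WeierstrassCurve ℚ) [E₀.IsElliptic] [E₀.IsGloballyMinimal] [E₁.IsElliptic] [E₁.IsGloballyMinimal],
    ∀ (c xnum₀ xnum₁ : ℤ[X]) (xden₀ xden₁ : ℕ) (B2 B4 B6 B2' B4' B6' : ℤ),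
      UnitPlaneSeedAtTwo E₀ c xnum₀ xden₀ B2 B4 B6 → UnitPlaneSeedAtTwo E₁ c xnum₁ xden₁ B2' B4' B6' →
        ∀ n : ℕ, RigidThreeCycleTwist E₀ n → RigidThreeCycleTwist E₁ n →
          (IncrementTrivialAtTwo E₀ n ↔ IncrementTrivialAtTwo E₁ n)

/-- **DESC-44-T `UnitPlaneTwistPairIncrementLawAtTwo` (RUNG of DESC-44-C; THEOREM-CANDIDATE, plain `def`).**  The sub-case where `E₁` is a quadratic TWIST of `E₀` (same `j`;
both unit-plane seeds with the same cubic datum — e.g. the box pairs `X25n2206 ~ X4n236`, `N = 5576, 44608`).  Besides the DESC-44-C assembly it also follows from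
Morgan–Smith 2024 Thm 8.4 over `K = ℚ(√D)` (rigidity over `K` + the dim-2 bit).  BC5 (kit j337311 P44.2): the 3 in-box twist pairs, increments agree 450/450 (naive 300/450: the pair `X25n2206` (rank 2) ~ `X4n236` (rank 0, `Ш[2] = Ũ`) has opposite
level-0 bits and opposite level-1 bits at all 150 common rigid primes).
Why it might fail: as DESC-44-C.  Sources: [cite: MorganSmith2024FieldChange, §8.2, Thm 8.4]; [cite: Morgan2023KummerGeneric, Prop. 19].
(RIDER, typer: PLAIN `def` (REF1 §290: SURVIVES, ⊂ DESC-44-C via the kernel glue `unitPlaneTwistPairIncrementLaw_of_congruent`, PROVED;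
44.2a additivity is Prop. 19's sum over `Ram χ` ✓; corollary-of-print, R290c).  REF2 placement: owed.
[cite: MorganSmith2024FieldChange, Thm 8.4]) -/
def UnitPlaneTwistPairIncrementLawAtTwo : Prop :=
  ∀ (E₀ E₁ : WeierstrassCurve ℚ) [E₀.IsElliptic] [E₀.IsGloballyMinimal] [E₁.IsElliptic] [E₁.IsGloballyMinimal],
    ∀ (c xnum₀ xnum₁ : ℤ[X]) (xden₀ xden₁ : ℕ) (B2 B4 B6 B2' B4' B6' : ℤ),
      UnitPlaneSeedAtTwo E₀ c xnum₀ xden₀ B2 B4 B6 → UnitPlaneSeedAtTwo E₁ c xnum₁ xden₁ B2' B4' B6' →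
        (∃ (D : ℤ) (C : VariableChange ℚ), C • E₀.quadraticTwist (D : ℚ) = E₁) →
          ∀ n : ℕ, RigidThreeCycleTwist E₀ n → RigidThreeCycleTwist E₁ n →
            (IncrementTrivialAtTwo E₀ n ↔ IncrementTrivialAtTwo E₁ n)

/-- **DESC-44-L0 `UnitPlaneCongruentCasselsTateSignDiffersAtTwo` (numerical ∃-fact, two engines; plain `def`).**  LEVEL 0 IS NOT CONGRUENCE-BLIND: there are two unit-plane
seeds with the same cubic datum and OPPOSITE level-0 bits — witnesses `X18n35 = [0,−1,0,−14,25]` (`N = 2788`, rank 2, `Sel₂ = δ(E(ℚ)) = Ũ`, `Ш[2] = 0`, `θ = +`) and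
`X4n236 = [0,0,0,−28,−40]` (`N = 44608`, rank 0, `Ш[2] = Ũ`, `θ = −`: VISIBILITY — the Ш-plane of one is the Mordell–Weil plane of the
other inside `H¹(ℚ, E[2])`), cubic field `x³ − 7x − 5` (`Δ_L = 697 = 17·41`), both all-OFF with `#Sel₂ = 4` (kit job43 `seedoff43-all.txt`), `θ` by PARI `ellrank` and
ENGINE CT-2 (kit j337311: 6 such congruent pairs + 1 twist pair, level-1 bits OPPOSITE at 1 050/1 050 common rigid primes).  With DESC-44-C: `(E[2], Sel₂)` determines the
rigid DERIVATIVE of `θ` but not `θ` (the level-0 discrepancy is §20's `u_{E,F}`; here it is rank 2 vs `Ш[2] ≅ (ℤ/2)²`).  Sources: MEMO-desc §20, §44; [cite: PoonenRains2012, Thm 4.13].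
(RIDER, typer -ty g21: `@[conjecture]` is the TYPER'S TAG — REF1 R290c classes this row «numerical» (an ∃-claim witnessed by two engines on named curves,
not a print corollary and not kernel-certified); -desc's «plain `def`» is superseded for the port so that the audit does not read an uncertified numerical
∃-claim as a vendored fact; a kit or kernel certificate of the two witnesses (`#Sel₂ = 4` all-OFF seeds `X18n35`, `X4n236` over `x³ − 7x − 5` with opposite `θ`)
would make it a theorem.  REF1-AUDIT §290: SURVIVES; K290.3: JUNK seeds CANNOT satisfy it (a junk seed has `E(ℚ)/2E ≅ (ℤ/2)²` filling `Sel₂` of order 4 ⟹ `Ш[2] = 0`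
⟹ `θ = +` on both) ✓ so the row keeps its intended content.  REF2 placement: owed.) -/
@[conjecture] def UnitPlaneCongruentCasselsTateSignDiffersAtTwo : Prop :=
  ∃ (E₀ E₁ : WeierstrassCurve ℚ) (_ : E₀.IsElliptic) (_ : E₀.IsGloballyMinimal) (_ : E₁.IsElliptic) (_ : E₁.IsGloballyMinimal)
    (c xnum₀ xnum₁ : ℤ[X]) (xden₀ xden₁ : ℕ) (B2 B4 B6 B2' B4' B6' : ℤ),
    UnitPlaneSeedAtTwo E₀ c xnum₀ xden₀ B2 B4 B6 ∧ UnitPlaneSeedAtTwo E₁ c xnum₁ xden₁ B2' B4' B6' ∧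
      ShaTwoInTwiceShaFour E₀ ∧ ¬ ShaTwoInTwiceShaFour E₁

/-! ### §44.10 row (job45 = kit j337376, job47 = j337396): the FLIPPED family -/

/-- FLIPPED 3-cycle twist at the odd bad prime `p`: as `RigidThreeCycleTwist` except that `n` is a NON-square at `p`
(`χ_n` unramified non-trivial at `p`; trivial at `2`, `∞` and every other bad prime; ramified only at `3`-cycle primes).
(RIDER, typer: carrier VERBATIM (Sketch44 v2 appended block).  REF1 §295 K295.1 (kernel `flipped_ne_one`): a flipped parameter is never `1`
(`(1/p) = 1 ≠ −1`); K295.2 (kernel `flipped_unsat_of_even_traces`): at a junk seed (all odd good traces even) NO `n` is flipped.) -/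
def FlippedThreeCycleTwist (W : WeierstrassCurve ℚ) [W.IsGloballyMinimal] (p n : ℕ) : Prop :=
  TwistSupportGoodOdd W n ∧ (n : ℤ) % 8 = 1 ∧ jacobiSym (n : ℤ) p = -1 ∧
    (∀ ℓ : ℕ, ℓ.Prime → ℓ ≠ 2 → ℓ ≠ p → (∀ _h : Fact ℓ.Prime, ¬ W.HasGoodReductionAtPrime ℓ) → jacobiSym (n : ℤ) ℓ = 1) ∧
    ∀ q : ℕ, q.Prime → q ∣ n → Odd (W.frobeniusTrace q)

/-- **DESC-44-F `UnitPlaneFlippedTwistSelmerCardAtTwo` (THM-CANDIDATE 44.4, descent side; in-print assembly + census).**  `W` a unit-plane seed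
(`Sel₂(W) = Ũ`, `dim 2`), `p` an ODD prime of MULTIPLICATIVE reduction with `p ∤ Δ_L` (`W[2]` unramified at `p`), `n` a flipped 3-cycle twist at `p`.
Then (i) `dim Sel₂(W^{(n)}) ∈ {1, 3}` (`#Sel₂ ∈ {2, 8}`): the root number flips (`χ_n(−N) = (n/p) = −1`), `2`-parity [Monsky 1996, Thm 1.5;
Dokchitser–Dokchitser 2010], and the Poitou–Tate Lagrangian trichotomy at the one changed local condition [Kramer 1981, Prop. 6 pattern; Mazur–Rubin 2010, §3];
(ii) `Sel₂(W^{(n)})` is the SAME subgroup of `H¹(G_{ℚ,2N∞}, W[2])` for every flipped `n` (locality: the conditions at `2`, `ℓ ≠ p`, `∞` are those of `W`,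
the condition at `p` is the `χ_p^{nr}`-twisted Kummer image — independent of `n` — and `H¹(ℚ_q, W[2]) = 0` at `q ∣ n`), so `#Sel₂(W^{(n)})` is CONSTANT in `n`.
Sharper (memo THM-CAND 44.4, not typed: needs local carriers): `dim = 1 ⟺ loc_p(Ũ) ⊄ 𝒲_p^{χ}`; for `p = 𝔭₁𝔭₂` (Frobenius a transposition) this reads
«some norm-one unit of `L` is a non-square mod `𝔭₁`».  CENSUS job45 (kit j337376): 7 seeds (all non-split `I₄` at `p = 3`, `c₃ = 2`), 1 096 flipped
prime twists `17 ≤ q ≤ 76 649`: `ellrank` `(r, R, s) = (1, 1, 0)` — `Sel₂ = ℤ/2`, rank `1` with a point FOUND, hence `Ш(W^{(q)})[2] = 0` — in 1 096/1 096;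
dim constant per seed 7/7; job47 (j337396): `loc₃(Ũ) ≠ 0` in 7/7 fields (consistent with `dim = 1`).  The analogue of T-A `AdmissibleTwistSelmerShiftAtTwo`
(flip at `∞`, PROVED in the kernel) with the flip moved to a multiplicative prime.  WHY IT MIGHT FAIL: (i)/(ii) are print-level; the typed row could
only fail through the model dictionary (`quadraticTwist` by `n` vs the character `χ_n`) or a mis-typed carrier.
[cite: Kramer1981, Prop. 6] [cite: Monsky1996, Thm. 1.5] [cite: MazurRubin2010, §3]
(RIDER, typer -ty g21: PLAIN `def` per REF1 §295 («support-grade PLAIN def on port, not `@[conjecture]`»).  REF1-AUDIT §295 (-ref1 g23; Probe295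
8d61c3a409a57fe8 = Sketch44 v2 cc7b15935ad3fb05 AS-IS + block `REF1_295`, farm rc 0 · 0 err · 0 warn · 0 sorry; negative control fails at `jacobiSym 1 3 = −1`):
**SURVIVES — COROLLARY-OF-PRINT assembly** (Monsky 1996 Thm 1.5 and Dokchitser–Dokchitser 2010 2-parity; Kramer 1981 Prop. 6 and Mazur–Rubin 2010 §3 one-place
Lagrangian switching; locality).  A2 verified on paper: (i) `w(W^{(n)}) = χ_n(−N)·w(W) = −w(W)` (`n ≡ 1 (8)`, `v_p(N) = 1`) and `w(W) = +1` from `dim Sel₂(W) = 2`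
EVEN with `W(ℚ)[2] = 0` — this step USES the irreducible cubic (R290a; at a junk seed `w = −1`, but there F is VACUOUS: kernel `flipped_unsat_of_even_traces`,
`desc44F_at_junkSeed`, K295.2/.3); (ii) `Sel₂(W^{(n)}) = S^♭ ⊂ H¹(G_{ℚ,Σ}, W[2])` is literally `n`-independent (`H¹(ℚ_q, W[2]) = 0` at 3-cycle `q`); (iii) one-place
switching at `p` with `d = 1` forced by parity ⟹ `dim S^♭ ∈ {1, 3}` ⟹ `#Sel₂ ∈ {2, 8}` ✓, and -desc's trichotomy criterion «`dim S^♭ = 1 ⟺ loc_p(Ũ) ⊄ 𝒲_p^χ`;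
`= 3 ⟺ loc_p(Ũ) ⊂ 𝒲_p ∩ 𝒲_p^χ`» VERIFIED.  A2′ (THM-cand 44.4 (iv), the local dictionary): CORRECT ON THE CARRIER with two write-up repairs (R295a, -desc memo):
«non-split `I_{2k}`» must read «non-split `I_{4j}`» (for `I_{4j+2}` the line `𝒲^{ns} ⊇ H¹_nr` FAILS — such a place is switched ON by THM 39.1 (ii), so it never occurs
under `UnitPlaneSeedAtTwo`), and the transposition-case generator is the non-identity-component point, not `δ(i)` (`i` is a square in `E^{ns}(ℚ₃)`; indeed
`U¹ = 2E^{ns}(ℚ_p)` there); the END criteria («`dim S^♭ = 1 ⟺ loc_p(Ũ) ≠ 0 ⟺` some norm-one unit of `L` is a non-square mod `𝔭₁`» at a transposition prime;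
«`⟺ loc_p(Ũ) ⊄ ⟨δ(η)⟩`» at a totally split prime) are RIGHT.  A3–A6: not vacuous globally (7 flip seeds × 1 096 flipped `q`, job45); mutations `Odd (a_q)`,
`(n/ℓ) = 1`, `n ≡ 1 (8)` each load-bearing; `p ∤ disc c` could be weakened to `p ∤ Δ_L` (cosmetic); degenerate `p` (split multiplicative, non-split `I_{4j+2}`) are
excluded by the seed's all-OFF clause, not by F's own binders — robust even if the carrier were weakened to «`Sel₂(W) = Ũ`».  R295b (DATA ASK, -desc or -data):
the first `dim = 3` instance (a flip seed whose two norm-one units are squares mod `𝔭₁`, or `loc_p(Ũ) ⊂ ⟨δ(η)⟩` at split `p`): predict `#Sel₂(W^{(q)}) = 8` for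
EVERY flipped `q`.  R295c: the sharper unit-residue criterion (iii)+(iv) needs local carriers — -desc's definition requests D44.1
`NormOneUnitNonsquareAtDegOnePrime c p` (pure Mathlib number-field algebra, typable) and D44.2 `twistKummerLocalAt W χ p` (local Kummer image at a multiplicative
prime — not in tree) are recorded by the typer as OPEN definition requests, not filed here.  REF2 placement: owed.
[cite: Monsky1996, Thm. 1.5]
[cite: DokchitserDokchitserAnnals2010]
[cite: Kramer1981, Prop. 6]
[cite: MazurRubin2010, §3]) -/
def UnitPlaneFlippedTwistSelmerCardAtTwo : Prop :=
  ∀ (W : WeierstrassCurve ℚ) [W.IsElliptic] [W.IsGloballyMinimal] (c xnum : ℤ[X]) (xden : ℕ) (B2 B4 B6 : ℤ),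
    UnitPlaneSeedAtTwo W c xnum xden B2 B4 B6 →
      ∀ (p : ℕ) (_hp : Fact p.Prime), p ≠ 2 → W.HasMultiplicativeReductionAtPrime p → ¬ (p : ℤ) ∣ cubicDiscZ c →
        ∀ n : ℕ, FlippedThreeCycleTwist W p n →
          (twistSelmerTwoCard W n = 2 ∨ twistSelmerTwoCard W n = 8) ∧
            ∀ n' : ℕ, FlippedThreeCycleTwist W p n' → twistSelmerTwoCard W n' = twistSelmerTwoCard W n

end Summit.BirchSwinnertonDyer.Rank1Residual.F1Sign2

end
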